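import Summits.Ventures.CertifiedManyBodySolver.Downfold.EmeryFermiScaleNode
import HarnessLib

/-!
# THE SCALE COORDINATE ALONG A STRAIGHT MOVE OF THE σ ROW: atoms of `t_node = scaleNodeN/scaleNodeD`, their exact difference quotients under
# `(θ, e) ↦ (θ + s·d, e + s·σ)`, the RATIO FORM `t′ = t·(1 + s·Ψ)` and the ratio form of the contour-nesting quadratic (INFL-3to1-B §B.88 (d)–(f))

Venture CertifiedManyBodySolver, cell `pub/hubbard-downfold` (stage S1; INFLATION-RULES-3to1-B §B.88), seat hubbard-downfold-mod-4 (technique B = band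
level, g36); namespace `Summit.Ventures.CertifiedManyBodySolver.Downfold.Emery`. Everything PROVED (0 sorry). WHAT THIS IS NOT: a statement about any
material; `U = 0` one-body kinematics of the σ (d–p_x–p_y + t_pp, t_pp′) model; no number lives here.

With `E = Δ + e`, `R = t_pd² − t_pp′e`, `G = t_pd² + t_pp e`, `P = 2t_pd² + (t_pp − t_pp′)e`, `Q = 2t_pd²E + eP`, `F = ER + 2(t_pp + t_pp′)P` (§1) the closed
forms of `EmeryFermiScaleNode` read `scaleNodeN = F·P²`, `scaleNodeD = 2EGQ`, and the contour coefficients of `EmeryFermiSurfaceShape` read `cA = eE²`,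
`fsD = ER`, `fsN = (t_pp + t_pp′)P`. Along the straight move `θ′ = θ + s·(dΔ, da, db, dc)`, `e′ = e + s·σ` every atom changes by `s` times an EXPLICIT
polynomial difference quotient (§2, `snX_move`). Hence (§3) `t_node(θ′, e′) = t_node(θ, e)·(1 + s·pathPsi s ρF ρP ρE ρG ρQ)` with the five RATES
`ρF = dF/F`, `ρP = dP/P`, `ρE = −dE/E′`, `ρG = −dG/G′`, `ρQ = −dQ/Q′` (`scaleNode_move_ratio`): the sign of `pathPsi` decides `t′ ≶ t` WITHOUT subtracting
two large products — the well-conditioned form the box checker `EmeryScaleLeverCheck` evaluates in rational interval arithmetic. §4 is the same service for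
the nesting quadratic of `EmeryContourNesting`: `q(x) = s·cA·4fsD·[(ρA − ρB) + (C/B)(ρA − ρC)x + (C/A)(ρC − ρB)x²]`.

Sources: three-band model [HybertsenSchluterChristensen1989, Eq. (1)]; energy-linearised one-band image [AndersenEtAl1995, §6]; arithmetic [folklore].
-/

noncomputable section

namespace Summit.Ventures.CertifiedManyBodySolver.Downfold.Emery

open Real Set

/-! ## §1 The atoms -/

/-- `E = Δ + e` (energy above the oxygen level). [folklore] -/
def snE (Δ e : ℝ) : ℝ := Δ + e

/-- `R = t_pd² − t_pp′·e` (`fsD = E·R`). [folklore] -/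
def snR (a c e : ℝ) : ℝ := a ^ 2 - c * e

/-- `G = t_pd² + t_pp·e`. [folklore] -/
def snG (a b e : ℝ) : ℝ := a ^ 2 + b * e

/-- `P = 2t_pd² + (t_pp − t_pp′)e` (`fsN = (t_pp + t_pp′)·P`, `fsN1 = 2P`). [folklore] -/
def snP (a b c e : ℝ) : ℝ := 2 * a ^ 2 + (b - c) * e

/-- `Q = 2t_pd²(Δ + e) + e·P = 2t_pd²(Δ + 2e) + (t_pp − t_pp′)e²`. [folklore] -/
def snQ (Δ a b c e : ℝ) : ℝ := 2 * a ^ 2 * (Δ + e) + e * snP a b c e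

/-- `F = E·R + 2(t_pp + t_pp′)·P = fsT`. [folklore] -/
def snF (Δ a b c e : ℝ) : ℝ := (Δ + e) * snR a c e + 2 * (b + c) * snP a b c e

section Atoms

variable (Δ a b c e : ℝ)

/-- `scaleNodeN = F·P²`. [folklore] -/
theorem scaleNodeN_eq_sn : scaleNodeN Δ a b c e = snF Δ a b c e * snP a b c e ^ 2 := by
  unfold scaleNodeN fsT fsD fsN snF snR snP; ring

/-- `scaleNodeD = 2·E·G·Q`. [folklore] -/
theorem scaleNodeD_eq_sn : scaleNodeD Δ a b c e = 2 * snE Δ e * snG a b e * snQ Δ a b c e := by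
  unfold scaleNodeD snE snG snQ snP; ring

/-- `cA = e·E²`. [folklore] -/
theorem cA_eq_sn : cA Δ e = e * snE Δ e ^ 2 := by unfold cA snE; ring

/-- `fsD = E·R`. [folklore] -/
theorem fsD_eq_sn : fsD Δ a c e = snE Δ e * snR a c e := by unfold fsD snE snR; ring

/-- `fsN = (t_pp + t_pp′)·P`. [folklore] -/
theorem fsN_eq_sn : fsN a b c e = (b + c) * snP a b c e := by unfold fsN snP; ring

/-- `fsT = F`. [folklore] -/
theorem fsT_eq_sn : fsT Δ a b c e = snF Δ a b c e := by unfold fsT fsD fsN snF snR snP; ring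

end Atoms

/-! ## §2 Exact difference quotients along a straight move `(θ, e) ↦ (θ + s·d, e + s·σ)` -/

/-- `dE = dΔ + σ`. [folklore] -/
def dsnE (dΔ σ : ℝ) : ℝ := dΔ + σ

/-- `dR = 2a·da − dc·e − c·σ + s(da² − dc·σ)`. [folklore] -/
def dsnR (a c e da dc σ s : ℝ) : ℝ := 2 * a * da - dc * e - c * σ + s * (da ^ 2 - dc * σ)

/-- `dG = 2a·da + db·e + b·σ + s(da² + db·σ)`. [folklore] -/
def dsnG (a b e da db σ s : ℝ) : ℝ := 2 * a * da + db * e + b * σ + s * (da ^ 2 + db * σ)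

/-- `dP = 4a·da + (db − dc)e + (b − c)σ + s(2da² + (db − dc)σ)`. [folklore] -/
def dsnP (a b c e da db dc σ s : ℝ) : ℝ := 4 * a * da + (db - dc) * e + (b - c) * σ + s * (2 * da ^ 2 + (db - dc) * σ)

/-- `dQ = 2[(2a·da + s·da²)(E + s·dE) + a²·dE] + σ(P + s·dP) + e·dP`. [folklore] -/
def dsnQ (Δ a b c e dΔ da db dc σ s : ℝ) : ℝ :=
  2 * ((2 * a * da + s * da ^ 2) * (snE Δ e + s * dsnE dΔ σ) + a ^ 2 * dsnE dΔ σ) +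
    (σ * (snP a b c e + s * dsnP a b c e da db dc σ s) + e * dsnP a b c e da db dc σ s)

/-- `dF = (dE·R + E·dR + s·dE·dR) + 2[(db + dc)(P + s·dP) + (b + c)dP]`. [folklore] -/
def dsnF (Δ a b c e dΔ da db dc σ s : ℝ) : ℝ :=
  (dsnE dΔ σ * snR a c e + snE Δ e * dsnR a c e da dc σ s + s * dsnE dΔ σ * dsnR a c e da dc σ s) +
    2 * ((db + dc) * (snP a b c e + s * dsnP a b c e da db dc σ s) + (b + c) * dsnP a b c e da db dc σ s)

/-- `dA = σ(E + s·dE)² + e(2E·dE + s·dE²)` (difference quotient of `cA = eE²`). [folklore] -/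
def dsnA (Δ e dΔ σ s : ℝ) : ℝ := σ * (snE Δ e + s * dsnE dΔ σ) ^ 2 + e * (2 * snE Δ e * dsnE dΔ σ + s * dsnE dΔ σ ^ 2)

/-- `dB = 4(dE·R + E·dR + s·dE·dR)` (difference quotient of `4fsD = 4ER`). [folklore] -/
def dsnB (Δ a c e dΔ da dc σ s : ℝ) : ℝ := 4 * (dsnE dΔ σ * snR a c e + snE Δ e * dsnR a c e da dc σ s + s * dsnE dΔ σ * dsnR a c e da dc σ s)

/-- `dC = 16[(db + dc)(P + s·dP) + (b + c)dP]` (difference quotient of `16fsN = 16(b + c)P`). [folklore] -/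
def dsnC (a b c e da db dc σ s : ℝ) : ℝ := 16 * ((db + dc) * (snP a b c e + s * dsnP a b c e da db dc σ s) + (b + c) * dsnP a b c e da db dc σ s)

section Move

variable (Δ a b c e dΔ da db dc σ s : ℝ)

/-- `E(θ′, e′) = E + s·dE`. [folklore] -/
theorem snE_move : snE (Δ + s * dΔ) (e + s * σ) = snE Δ e + s * dsnE dΔ σ := by unfold snE dsnE; ring

/-- `R(θ′, e′) = R + s·dR`. [folklore] -/
theorem snR_move : snR (a + s * da) (c + s * dc) (e + s * σ) = snR a c e + s * dsnR a c e da dc σ s := by unfold snR dsnR; ring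

/-- `G(θ′, e′) = G + s·dG`. [folklore] -/
theorem snG_move : snG (a + s * da) (b + s * db) (e + s * σ) = snG a b e + s * dsnG a b e da db σ s := by unfold snG dsnG; ring

/-- `P(θ′, e′) = P + s·dP`. [folklore] -/
theorem snP_move : snP (a + s * da) (b + s * db) (c + s * dc) (e + s * σ) = snP a b c e + s * dsnP a b c e da db dc σ s := by
  unfold snP dsnP; ring

/-- `Q(θ′, e′) = Q + s·dQ`. [folklore] -/
theorem snQ_move : snQ (Δ + s * dΔ) (a + s * da) (b + s * db) (c + s * dc) (e + s * σ) = snQ Δ a b c e + s * dsnQ Δ a b c e dΔ da db dc σ s := by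
  unfold snQ dsnQ snP dsnP snE dsnE; ring

/-- `F(θ′, e′) = F + s·dF`. [folklore] -/
theorem snF_move : snF (Δ + s * dΔ) (a + s * da) (b + s * db) (c + s * dc) (e + s * σ) = snF Δ a b c e + s * dsnF Δ a b c e dΔ da db dc σ s := by
  unfold snF dsnF snR dsnR snP dsnP snE dsnE; ring

/-- `cA(θ′, e′) = cA + s·dA`. [folklore] -/
theorem cA_move : cA (Δ + s * dΔ) (e + s * σ) = cA Δ e + s * dsnA Δ e dΔ σ s := by unfold cA dsnA snE dsnE; ring

/-- `4fsD(θ′, e′) = 4fsD + s·dB`. [folklore] -/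
theorem four_fsD_move : 4 * fsD (Δ + s * dΔ) (a + s * da) (c + s * dc) (e + s * σ) = 4 * fsD Δ a c e + s * dsnB Δ a c e dΔ da dc σ s := by
  unfold fsD dsnB snE dsnE snR dsnR; ring

/-- `16fsN(θ′, e′) = 16fsN + s·dC`. [folklore] -/
theorem sixteen_fsN_move : 16 * fsN (a + s * da) (b + s * db) (c + s * dc) (e + s * σ) = 16 * fsN a b c e + s * dsnC a b c e da db dc σ s := by
  unfold fsN dsnC snP dsnP; ring

end Move

/-! ## §3 The ratio form of the scale along a move -/

/-- `pathPsi s ρF ρP ρE ρG ρQ` — the polynomial with `1 + s·pathPsi = (1 + sρF)(1 + sρP)²(1 + sρE)(1 + sρG)(1 + sρQ)`, built by the recursion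
`u ↦ u + ρ + s·u·ρ` (the form evaluated by the interval checker). [folklore] -/
def pathPsi (s ρF ρP ρE ρG ρQ : ℝ) : ℝ :=
  let u₂ := ρF + ρP + s * ρF * ρP
  let u₃ := u₂ + ρP + s * u₂ * ρP
  let u₄ := u₃ + ρE + s * u₃ * ρE
  let u₅ := u₄ + ρG + s * u₄ * ρG
  u₅ + ρQ + s * u₅ * ρQ

/-- `1 + s·pathPsi = (1 + sρF)(1 + sρP)²(1 + sρE)(1 + sρG)(1 + sρQ)`. [folklore] -/
theorem one_add_mul_pathPsi (s ρF ρP ρE ρG ρQ : ℝ) :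
    1 + s * pathPsi s ρF ρP ρE ρG ρQ = (1 + s * ρF) * (1 + s * ρP) ^ 2 * (1 + s * ρE) * (1 + s * ρG) * (1 + s * ρQ) := by
  unfold pathPsi; ring

/-- **THE CROSS IDENTITY IN RATIO FORM**: with the rates `ρF·F = dF`, `ρP·P = dP`, `ρE·E′ = −dE`, `ρG·G′ = −dG`, `ρQ·Q′ = −dQ` (`X′ = X + s·dX`),
`(F′P′²)·(2EGQ) = (FP²)·(2E′G′Q′)·(1 + s·pathPsi)`. [folklore] -/
theorem scaleNode_cross_ratio {F P E G Q dF dP dE dG dQ s ρF ρP ρE ρG ρQ : ℝ} (hF : ρF * F = dF) (hP : ρP * P = dP)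
    (hE : ρE * (E + s * dE) = -dE) (hG : ρG * (G + s * dG) = -dG) (hQ : ρQ * (Q + s * dQ) = -dQ) :
    ((F + s * dF) * (P + s * dP) ^ 2) * (2 * E * G * Q) =
      (F * P ^ 2) * (2 * (E + s * dE) * (G + s * dG) * (Q + s * dQ)) * (1 + s * pathPsi s ρF ρP ρE ρG ρQ) := by
  rw [one_add_mul_pathPsi]
  have h1 : F + s * dF = F * (1 + s * ρF) := by linear_combination (-s) * hF
  have h2 : P + s * dP = P * (1 + s * ρP) := by linear_combination (-s) * hP
  have h3 : E = (E + s * dE) * (1 + s * ρE) := by linear_combination (-s) * hE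
  have h4 : G = (G + s * dG) * (1 + s * ρG) := by linear_combination (-s) * hG
  have h5 : Q = (Q + s * dQ) * (1 + s * ρQ) := by linear_combination (-s) * hQ
  rw [h1, h2]
  conv_lhs => rw [h3, h4, h5]
  ring

/-- **`t′ = t·(1 + s·Ψ)`**: `(F′P′²)/(2E′G′Q′) = (FP²)/(2EGQ)·(1 + s·pathPsi)` (denominators non-zero). [folklore] -/
theorem scaleNode_move_ratio {F P E G Q dF dP dE dG dQ s ρF ρP ρE ρG ρQ : ℝ} (hF : ρF * F = dF) (hP : ρP * P = dP)
    (hE : ρE * (E + s * dE) = -dE) (hG : ρG * (G + s * dG) = -dG) (hQ : ρQ * (Q + s * dQ) = -dQ) (hD : 2 * E * G * Q ≠ 0)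
    (hD' : 2 * (E + s * dE) * (G + s * dG) * (Q + s * dQ) ≠ 0) :
    ((F + s * dF) * (P + s * dP) ^ 2) / (2 * (E + s * dE) * (G + s * dG) * (Q + s * dQ)) =
      (F * P ^ 2) / (2 * E * G * Q) * (1 + s * pathPsi s ρF ρP ρE ρG ρQ) := by
  have key := scaleNode_cross_ratio hF hP hE hG hQ
  rw [div_mul_eq_mul_div, div_eq_div_iff hD' hD]
  linear_combination key

/-- **SIGN RULES**: `t ≥ 0`, `s ≥ 0`: `Ψ ≤ 0 ⇒ t′ ≤ t` and `0 ≤ Ψ ⇒ t ≤ t′` (for `t′ = t(1 + sΨ)`). [folklore] -/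
theorem le_of_ratio_form {t t' s Ψ : ℝ} (h : t' = t * (1 + s * Ψ)) (ht : 0 ≤ t) (hs : 0 ≤ s) :
    (Ψ ≤ 0 → t' ≤ t) ∧ (0 ≤ Ψ → t ≤ t') := by
  constructor
  · intro hΨ
    have : t * (s * Ψ) ≤ 0 := mul_nonpos_iff.2 (Or.inl ⟨ht, mul_nonpos_iff.2 (Or.inl ⟨hs, hΨ⟩)⟩)
    nlinarith
  · intro hΨ
    have : 0 ≤ t * (s * Ψ) := mul_nonneg ht (mul_nonneg hs hΨ)
    nlinarith

/-! ## §4 The ratio form of the nesting quadratic -/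

/-- **THE NESTING QUADRATIC IN RATIO FORM**: with `ρA·A = dA`, `ρB·B = dB`, `ρC·C = dC` (`A, B > 0`, `s ≥ 0`) and
`q̂(x) = (ρA − ρB) + (C/B)(ρA − ρC)x + (C/A)(ρC − ρB)x² ≥ 0`, the nesting quadratic of `EmeryContourNesting` for the pair
`(A, B, C) → (A + s·dA, B + s·dB, C + s·dC)` is non-negative: `q(x) = s·A·B·q̂(x) ≥ 0`. [folklore] -/
theorem nestQuad_nonneg_of_ratio {A B C dA dB dC s ρA ρB ρC x : ℝ} (hA : 0 < A) (hB : 0 < B) (hs : 0 ≤ s) (hρA : ρA * A = dA)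
    (hρB : ρB * B = dB) (hρC : ρC * C = dC) (hq : 0 ≤ (ρA - ρB) + (C / B * (ρA - ρC)) * x + (C / A * (ρC - ρB)) * x ^ 2) :
    0 ≤ ((A + s * dA) * B - A * (B + s * dB)) + ((A + s * dA) * C - A * (C + s * dC)) * x +
      (B * (C + s * dC) - (B + s * dB) * C) * x ^ 2 := by
  have e : ((A + s * dA) * B - A * (B + s * dB)) + ((A + s * dA) * C - A * (C + s * dC)) * x + (B * (C + s * dC) - (B + s * dB) * C) * x ^ 2 =
      (s * A * B) * ((ρA - ρB) + (C / B * (ρA - ρC)) * x + (C / A * (ρC - ρB)) * x ^ 2) := by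
    rw [← hρA, ← hρB, ← hρC]
    field_simp
    ring
  rw [e]
  exact mul_nonneg (by positivity) hq

/-! ## §5 Positivity of the atoms in the regime -/

section Pos

variable {Δ a b c e : ℝ}

/-- `E > 0` for `Δ + e > 0`. [folklore] -/
theorem snE_pos (h : 0 < Δ + e) : 0 < snE Δ e := h

/-- `R > 0` for `t_pp′e < t_pd²`. [folklore] -/
theorem snR_pos (h : c * e < a ^ 2) : 0 < snR a c e := by unfold snR; linarith

/-- `G > 0` for `t_pd ≠ 0`, `t_pp, e ≥ 0`. [folklore] -/
theorem snG_pos (ha : a ≠ 0) (hb : 0 ≤ b) (he : 0 ≤ e) : 0 < snG a b e := by unfold snG; positivity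

/-- `P > 0` for `t_pd ≠ 0`, `t_pp′ ≤ t_pp`, `e ≥ 0`. [folklore] -/
theorem snP_pos (ha : a ≠ 0) (hcb : c ≤ b) (he : 0 ≤ e) : 0 < snP a b c e := by
  unfold snP; have : 0 ≤ (b - c) * e := mul_nonneg (by linarith) he; positivity

/-- `Q > 0` for `t_pd ≠ 0`, `t_pp′ ≤ t_pp`, `e ≥ 0`, `Δ + e > 0`. [folklore] -/
theorem snQ_pos (ha : a ≠ 0) (hcb : c ≤ b) (he : 0 ≤ e) (hE : 0 < Δ + e) : 0 < snQ Δ a b c e := by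
  unfold snQ; have := snP_pos ha hcb he; positivity

/-- `F > 0` for `t_pd ≠ 0`, `0 ≤ t_pp′ ≤ t_pp`, `e ≥ 0`, `Δ + e > 0`, `t_pp′e < t_pd²`. [folklore] -/
theorem snF_pos (ha : a ≠ 0) (hc : 0 ≤ c) (hcb : c ≤ b) (he : 0 ≤ e) (hE : 0 < Δ + e) (hR : c * e < a ^ 2) : 0 < snF Δ a b c e := by
  unfold snF; have := snP_pos ha hcb he; have := snR_pos hR; have : 0 ≤ b + c := by linarith
  positivity

/-- `t_node(θ, e) = F·P²/(2EGQ)` in atoms (`EmeryFermiScaleNode.scaleT_node_eq` rewritten). [folklore] -/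
theorem scaleT_node_eq_sn (hE : 0 < Δ + e) (he : 0 ≤ e) (hc : 0 ≤ c) (hcb : c ≤ b) (ha : a ≠ 0) :
    scaleT Δ a b c (xNode Δ a b c e) (xNode Δ a b c e) e = snF Δ a b c e * snP a b c e ^ 2 / (2 * snE Δ e * snG a b e * snQ Δ a b c e) := by
  rw [scaleT_node_eq hE he hc hcb ha, scaleNodeN_eq_sn, scaleNodeD_eq_sn]

end Pos

end Summit.Ventures.CertifiedManyBodySolver.Downfold.Emery
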